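import Literature.NumberTheory.Rogawski1990.AdelicStableClassesProduct
import Literature.NumberTheory.Rogawski1990.AdelicStableOrbitalIntegral
import Literature.Topology.Algebra.RestrictedProduct.FinsumProdReindex
import HarnessLib

/-!
# `Σ_{𝒞_𝐀(γ₀)} Φ(δ, f) = Φ_∞ · ∏_{v ∈ S} Φ_v` for EVERY adelic orbital family whose class orbital integrals factor through the local classes
(Rogawski (1990), §4.3 p. 44 «we may therefore set `Φ^κ(γ, f) = Π_v Φ^{κ_v}(γ, f_v)` … the sum is finite»; §5.4 (5.4.3) pp. 72–73; Kottwitz (1986) Prop. 7.1)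

Topic `NumberTheory/Rogawski1990`; namespace `Literature.NumberTheory.Rogawski1990` (sequel of ★ (E2) `AdelicStableClassesProduct` over ★ (E1)
`Literature.Topology.Algebra.RestrictedProduct.FinsumProdReindex` and ★ typ3 `AdelicStableOrbitalIntegral`).  THEOREMS ONLY: no definition, no named
fact, no instance, no `sorry`.  Cell `pub/hodgecm-mathlib`, ENGINE T1, ED 1.19c (xii-d) ∕ O11.

THE STATEMENT (`G = U(Φ₃)`, `γ₀ ∈ U(H)(L⁺)` regular with rational correspondent `γ ∈ U(Φ₃)(L⁺)`, ★ `MatchingAdeleGEventuallyKConj L H`).  Let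
`m : OrbitalMeasureFamily U(Φ₃)(𝔸)` be ANY adelic class-indexed family and `f` ANY function whose class orbital integrals on `𝒞_𝐀(γ₀) =
MatchingAdeleG.classes L H γ₀` FACTOR through the local and archimedean classes, `Φ_m(c, f) = φ_∞(c_∞) · ∏ᶠ_v φ_v(c_v)`, with `φ_v(⟦γ_v⟧) = 1` and
`φ_v = 0` on the other classes of the local stable class for `v ∉ S`, and finite supports on the stable classes for `v ∈ S` and at `∞`.  Then
`adelicStableOrbitalSum (MatchingAdeleG.classes L H γ₀) m f = (∑ᶠ b ∈ 𝒞_∞, φ_∞ b) * ∏ v ∈ S, ∑ᶠ d ∈ 𝒞_v, φ_v d` with `𝒞_v = {d | (γ₀)_v ↔ out d}`,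
`𝒞_∞ = {b | γ₀ ⊗ 1 ↔ out b}` (`MatchingAdeleG.adelicStableOrbitalSum_eq_finsum_mul_prod_finsum`) — ★ (E1) with the dictionary ★ (E2).  §2 reads the
inner sums as the tree's LOCAL ∕ ARCHIMEDEAN STABLE ORBITAL INTEGRALS at `γ_v`, `γ ⊗ 1` (★ `localStableOrbitalIntegral`, ★ `archStableOrbitalIntegral`:
`𝒞_v` IS the set of classes stably conjugate to `γ_v`), giving ★ typ3's relation **`IsEulerOnClasses`** for such `(m, f)`
(`MatchingAdeleG.isEulerOnClasses_of_factor`).  The factorisation and the three local behaviours are HYPOTHESES here; for the kit's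
`m := ofLocalAdelic mq mqi` and an `IsTest` pure tensor they are ★ C3 `classOrbitalIntegral_ofLocalAdelic_eval_eq_mul_prod`, ★ (S)
`eventually_classOrbitalIntegral_indicator_eq_one`, [Kt₄] 7.1 with ★ O15c, and ★ O15e∕O15f (the sequel file).
HC_CM is proved only modulo the printed citations until rung 0 closes; this file is unconditional ([Kt₄] 7.1 enters BY NAME as a hypothesis).

## References
* [Rogawski1990] J. D. Rogawski, *Automorphic Representations of Unitary Groups in Three Variables*, Ann. of Math. Stud. 123 (1990), §4.1 (4.1.1) p. 39,
  §4.3 p. 44, §5.4 (5.4.3) pp. 72–73.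
* [Kottwitz1986] R. E. Kottwitz, *Stable trace formula: elliptic singular terms*, Math. Ann. 275 (1986), Prop. 7.1, §7.3.
-/

noncomputable section

open NumberField IsDedekindDomain Filter Function
open scoped MatrixGroups

namespace Literature.NumberTheory.Rogawski1990

open Literature.NumberTheory.Automorphic Literature.Topology.Algebra.RestrictedProduct

section Factor

variable {L : Type} [Field L] [NumberField L] [IsCMField L] {H : Matrix (Fin 3) (Fin 3) L}
  {γ₀ : (UnitaryGroup.cmDatum L 3 H).Rational}
  [∀ g : (UnitaryGroup.cmDatum L 3 (Matrix.of fun i j : Fin 3 => if i.val + j.val + 1 = 3 then (1 : L) else 0)).Adelic,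
    MeasurableSpace ((UnitaryGroup.cmDatum L 3 (Matrix.of fun i j : Fin 3 => if i.val + j.val + 1 = 3 then (1 : L) else 0)).Adelic ⧸
      Subgroup.centralizer ({g} : Set (UnitaryGroup.cmDatum L 3 (Matrix.of fun i j : Fin 3 => if i.val + j.val + 1 = 3 then (1 : L) else 0)).Adelic))]

/-! ## §1 The factored adelic stable sum -/

/-- **`Σ_{𝒞_𝐀(γ₀)} Φ_m(δ, f) = (Σ_{𝒞_∞} φ_∞) · ∏_{v ∈ S} Σ_{𝒞_v} φ_v`** for every adelic family `m` and function `f` whose class orbital integrals on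
`𝒞_𝐀(γ₀)` factor through the local ∕ archimedean classes (`hfac`), with `φ_v(⟦γ_v⟧) = 1` (`h1`) and `φ_v = 0` on the rest of the local stable class
(`h0`) off the finite set `S`, and finite supports on the stable classes (`hfin`, `hfinₐ`) — ★ (E1) `finsum_mem_eq_finsum_mul_prod_finsum_of_factor` on
the dictionary ★ (E2) (inj = gluing, ev = [Kt₄] 7.1 ★ `MatchingAdeleGEventuallyKConj`, surj = adèles with prescribed components).
[cite: Rogawski1990, §4.3 p. 44; §5.4 (5.4.3) pp. 72–73] [cite: Kottwitz1986, Prop. 7.1] -/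
theorem MatchingAdeleG.adelicStableOrbitalSum_eq_finsum_mul_prod_finsum (hKC : MatchingAdeleGEventuallyKConj L H)
    (hreg : IsRegularElt (γ₀.val : GL (Fin 3) L))
    {γ : (UnitaryGroup.cmDatum L 3 (Matrix.of fun i j : Fin 3 => if i.val + j.val + 1 = 3 then (1 : L) else 0)).Rational}
    (hγ : Corresponds (cmConjRingHom L) H (Matrix.of fun i j : Fin 3 => if i.val + j.val + 1 = 3 then (1 : L) else 0) γ₀ γ)
    (m : OrbitalMeasureFamily (UnitaryGroup.cmDatum L 3 (Matrix.of fun i j : Fin 3 => if i.val + j.val + 1 = 3 then (1 : L) else 0)).Adelic)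
    (f : (UnitaryGroup.cmDatum L 3 (Matrix.of fun i j : Fin 3 => if i.val + j.val + 1 = 3 then (1 : L) else 0)).Adelic → ℂ)
    (φ : ∀ v : HeightOneSpectrum (𝓞 ↥(maximalRealSubfield L)),
      ConjClasses ((UnitaryGroup.cmDatum L 3 (Matrix.of fun i j : Fin 3 => if i.val + j.val + 1 = 3 then (1 : L) else 0)).Local v) → ℂ)
    (φₐ : ConjClasses (UnitaryGroup.arch (↥(maximalRealSubfield L)) L (IsCMField.complexConj L) 3
      (Matrix.of fun i j : Fin 3 => if i.val + j.val + 1 = 3 then (1 : L) else 0)) → ℂ)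
    (S : Finset (HeightOneSpectrum (𝓞 ↥(maximalRealSubfield L))))
    (hfac : ∀ c ∈ MatchingAdeleG.classes L H γ₀, classOrbitalIntegral m f c =
      φₐ (ConjClasses.map (UnitaryGroup.archPart (↥(maximalRealSubfield L)) L (IsCMField.complexConj L) 3
        (Matrix.of fun i j : Fin 3 => if i.val + j.val + 1 = 3 then (1 : L) else 0)) c) *
        ∏ᶠ v, φ v (ConjClasses.map ((UnitaryGroup.cmDatum L 3
          (Matrix.of fun i j : Fin 3 => if i.val + j.val + 1 = 3 then (1 : L) else 0)).toLocal v) c))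
    (h1 : ∀ v ∉ S, φ v (ConjClasses.mk ((UnitaryGroup.cmDatum L 3
      (Matrix.of fun i j : Fin 3 => if i.val + j.val + 1 = 3 then (1 : L) else 0)).toLocal v
        ((UnitaryGroup.cmDatum L 3 (Matrix.of fun i j : Fin 3 => if i.val + j.val + 1 = 3 then (1 : L) else 0)).toAdelic γ))) = 1)
    (h0 : ∀ v ∉ S, ∀ d, Corresponds (UnitaryGroup.conjLocal L (IsCMField.complexConj L) v)
        ((UnitaryGroup.adelicForm L 3 H).map (UnitaryGroup.adeleToLocal L v))
        ((UnitaryGroup.adelicForm L 3 (Matrix.of fun i j : Fin 3 => if i.val + j.val + 1 = 3 then (1 : L) else 0)).map (UnitaryGroup.adeleToLocal L v))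
        ((UnitaryGroup.cmDatum L 3 H).toLocal v ((UnitaryGroup.cmDatum L 3 H).toAdelic γ₀)) (Quotient.out d) →
      d ≠ ConjClasses.mk ((UnitaryGroup.cmDatum L 3
        (Matrix.of fun i j : Fin 3 => if i.val + j.val + 1 = 3 then (1 : L) else 0)).toLocal v
          ((UnitaryGroup.cmDatum L 3 (Matrix.of fun i j : Fin 3 => if i.val + j.val + 1 = 3 then (1 : L) else 0)).toAdelic γ)) → φ v d = 0)
    (hfin : ∀ v ∈ S, (support (φ v) ∩ {d | Corresponds (UnitaryGroup.conjLocal L (IsCMField.complexConj L) v)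
        ((UnitaryGroup.adelicForm L 3 H).map (UnitaryGroup.adeleToLocal L v))
        ((UnitaryGroup.adelicForm L 3 (Matrix.of fun i j : Fin 3 => if i.val + j.val + 1 = 3 then (1 : L) else 0)).map (UnitaryGroup.adeleToLocal L v))
        ((UnitaryGroup.cmDatum L 3 H).toLocal v ((UnitaryGroup.cmDatum L 3 H).toAdelic γ₀)) (Quotient.out d)}).Finite)
    (hfinₐ : (support φₐ ∩ {b | Corresponds (UnitaryGroup.conjMixed (↥(maximalRealSubfield L)) L (IsCMField.complexConj L)) (UnitaryGroup.archFormOf L 3 H)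
        (UnitaryGroup.archFormOf L 3 (Matrix.of fun i j : Fin 3 => if i.val + j.val + 1 = 3 then (1 : L) else 0))
        (cmRationalToArch L 3 H γ₀) (Quotient.out b)}).Finite) :
    adelicStableOrbitalSum (MatchingAdeleG.classes L H γ₀) m f =
      (∑ᶠ b ∈ {b | Corresponds (UnitaryGroup.conjMixed (↥(maximalRealSubfield L)) L (IsCMField.complexConj L)) (UnitaryGroup.archFormOf L 3 H)
          (UnitaryGroup.archFormOf L 3 (Matrix.of fun i j : Fin 3 => if i.val + j.val + 1 = 3 then (1 : L) else 0))
          (cmRationalToArch L 3 H γ₀) (Quotient.out b)}, φₐ b) *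
        ∏ v ∈ S, ∑ᶠ d ∈ {d | Corresponds (UnitaryGroup.conjLocal L (IsCMField.complexConj L) v)
          ((UnitaryGroup.adelicForm L 3 H).map (UnitaryGroup.adeleToLocal L v))
          ((UnitaryGroup.adelicForm L 3 (Matrix.of fun i j : Fin 3 => if i.val + j.val + 1 = 3 then (1 : L) else 0)).map (UnitaryGroup.adeleToLocal L v))
          ((UnitaryGroup.cmDatum L 3 H).toLocal v ((UnitaryGroup.cmDatum L 3 H).toAdelic γ₀)) (Quotient.out d)}, φ v d := by
  rw [adelicStableOrbitalSum_def]
  refine finsum_mem_eq_finsum_mul_prod_finsum_of_factor (MatchingAdeleG.classes L H γ₀)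
    (fun c v => ConjClasses.map ((UnitaryGroup.cmDatum L 3
      (Matrix.of fun i j : Fin 3 => if i.val + j.val + 1 = 3 then (1 : L) else 0)).toLocal v) c)
    (fun c => ConjClasses.map (UnitaryGroup.archPart (↥(maximalRealSubfield L)) L (IsCMField.complexConj L) 3
      (Matrix.of fun i j : Fin 3 => if i.val + j.val + 1 = 3 then (1 : L) else 0)) c)
    (fun v => {d | Corresponds (UnitaryGroup.conjLocal L (IsCMField.complexConj L) v)
        ((UnitaryGroup.adelicForm L 3 H).map (UnitaryGroup.adeleToLocal L v))
        ((UnitaryGroup.adelicForm L 3 (Matrix.of fun i j : Fin 3 => if i.val + j.val + 1 = 3 then (1 : L) else 0)).map (UnitaryGroup.adeleToLocal L v))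
        ((UnitaryGroup.cmDatum L 3 H).toLocal v ((UnitaryGroup.cmDatum L 3 H).toAdelic γ₀)) (Quotient.out d)})
    (fun v => ConjClasses.mk ((UnitaryGroup.cmDatum L 3
      (Matrix.of fun i j : Fin 3 => if i.val + j.val + 1 = 3 then (1 : L) else 0)).toLocal v
        ((UnitaryGroup.cmDatum L 3 (Matrix.of fun i j : Fin 3 => if i.val + j.val + 1 = 3 then (1 : L) else 0)).toAdelic γ)))
    _ (classOrbitalIntegral m f) φ φₐ S (fun v => ?_) ?_ ?_ ?_ ?_ hfac h1 (fun v hv d hd hne => h0 v hv d hd hne) hfin hfinₐ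
  · -- (he) the base class lies in the local stable class
    exact (corresponds_toLocal_toAdelic hγ v).of_isStablyConj_right (isStablyConj_of_isConj (isConj_out_conjClasses_mk _))
  · -- (inj) the gluing
    intro c hc c' hc' h
    have h1' := congrArg Prod.fst h
    have h2' := congrArg Prod.snd h
    exact MatchingAdeleG.eq_of_forall_map_toLocal_eq_of_map_archPart_eq hKC hreg hγ hc hc' (fun v => congrFun h1' v) h2'
  · -- (img)
    exact fun c hc => ⟨fun v => MatchingAdeleG.corresponds_out_map_toLocal hc v, MatchingAdeleG.corresponds_out_map_archPart hc⟩
  · -- (ev) [Kt₄] 7.1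
    exact fun c hc => MatchingAdeleG.eventually_map_toLocal_eq_mk hKC hreg hγ hc
  · -- (surj)
    intro δ b hδ hev hb
    obtain ⟨c, hc, hcv, hcb⟩ := MatchingAdeleG.exists_mem_classes_of_forall hγ δ b hδ hev hb
    exact ⟨c, hc, funext hcv, hcb⟩


/-- `ConjClasses.map f c = [f (out c)]`. [cite: BorelJacquet1979, §4.1] -/
theorem conjClasses_map_eq_mk_out {A B : Type*} [Monoid A] [Monoid B] (f : A →* B) (c : ConjClasses A) :
    ConjClasses.map f c = ConjClasses.mk (f (Quotient.out c)) := by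
  conv_lhs => rw [← conjClasses_mk_out_eq c]
  rfl

/-- **The same, with the factorisation given on FINITE sets of places** (the shape ★ C3 `classOrbitalIntegral_ofLocalAdelic_eval_eq_mul_prod` and ★ (S)
`exists_finset_forall_classOrbitalIntegral_loc_eq_one` deliver): for each `c ∈ 𝒞_𝐀(γ₀)` a finite `S₂` with `φ_v([(out c)_v]) = 1` off `S₂` and
`Φ_m(c, f) = φ_∞([(out c)_∞]) · ∏_{v ∈ S₂} φ_v([(out c)_v])`. [cite: Rogawski1990, §4.3 p. 44; §5.4 (5.4.3) pp. 72–73] [cite: Kottwitz1986, Prop. 7.1] -/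
theorem MatchingAdeleG.adelicStableOrbitalSum_eq_finsum_mul_prod_finsum_of_finset (hKC : MatchingAdeleGEventuallyKConj L H)
    (hreg : IsRegularElt (γ₀.val : GL (Fin 3) L))
    {γ : (UnitaryGroup.cmDatum L 3 (Matrix.of fun i j : Fin 3 => if i.val + j.val + 1 = 3 then (1 : L) else 0)).Rational}
    (hγ : Corresponds (cmConjRingHom L) H (Matrix.of fun i j : Fin 3 => if i.val + j.val + 1 = 3 then (1 : L) else 0) γ₀ γ)
    (m : OrbitalMeasureFamily (UnitaryGroup.cmDatum L 3 (Matrix.of fun i j : Fin 3 => if i.val + j.val + 1 = 3 then (1 : L) else 0)).Adelic)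
    (f : (UnitaryGroup.cmDatum L 3 (Matrix.of fun i j : Fin 3 => if i.val + j.val + 1 = 3 then (1 : L) else 0)).Adelic → ℂ)
    (φ : ∀ v : HeightOneSpectrum (𝓞 ↥(maximalRealSubfield L)),
      ConjClasses ((UnitaryGroup.cmDatum L 3 (Matrix.of fun i j : Fin 3 => if i.val + j.val + 1 = 3 then (1 : L) else 0)).Local v) → ℂ)
    (φₐ : ConjClasses (UnitaryGroup.arch (↥(maximalRealSubfield L)) L (IsCMField.complexConj L) 3
      (Matrix.of fun i j : Fin 3 => if i.val + j.val + 1 = 3 then (1 : L) else 0)) → ℂ)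
    (S : Finset (HeightOneSpectrum (𝓞 ↥(maximalRealSubfield L))))
    (hfac : ∀ c ∈ MatchingAdeleG.classes L H γ₀, ∃ S₂ : Finset (HeightOneSpectrum (𝓞 ↥(maximalRealSubfield L))),
      (∀ v ∉ S₂, φ v (ConjClasses.mk ((UnitaryGroup.cmDatum L 3
        (Matrix.of fun i j : Fin 3 => if i.val + j.val + 1 = 3 then (1 : L) else 0)).toLocal v (Quotient.out c))) = 1) ∧
      classOrbitalIntegral m f c =
        φₐ (ConjClasses.mk (UnitaryGroup.archPart (↥(maximalRealSubfield L)) L (IsCMField.complexConj L) 3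
          (Matrix.of fun i j : Fin 3 => if i.val + j.val + 1 = 3 then (1 : L) else 0) (Quotient.out c))) *
        ∏ v ∈ S₂, φ v (ConjClasses.mk ((UnitaryGroup.cmDatum L 3
          (Matrix.of fun i j : Fin 3 => if i.val + j.val + 1 = 3 then (1 : L) else 0)).toLocal v (Quotient.out c))))
    (h1 : ∀ v ∉ S, φ v (ConjClasses.mk ((UnitaryGroup.cmDatum L 3
      (Matrix.of fun i j : Fin 3 => if i.val + j.val + 1 = 3 then (1 : L) else 0)).toLocal v
        ((UnitaryGroup.cmDatum L 3 (Matrix.of fun i j : Fin 3 => if i.val + j.val + 1 = 3 then (1 : L) else 0)).toAdelic γ))) = 1)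
    (h0 : ∀ v ∉ S, ∀ d, Corresponds (UnitaryGroup.conjLocal L (IsCMField.complexConj L) v)
        ((UnitaryGroup.adelicForm L 3 H).map (UnitaryGroup.adeleToLocal L v))
        ((UnitaryGroup.adelicForm L 3 (Matrix.of fun i j : Fin 3 => if i.val + j.val + 1 = 3 then (1 : L) else 0)).map (UnitaryGroup.adeleToLocal L v))
        ((UnitaryGroup.cmDatum L 3 H).toLocal v ((UnitaryGroup.cmDatum L 3 H).toAdelic γ₀)) (Quotient.out d) →
      d ≠ ConjClasses.mk ((UnitaryGroup.cmDatum L 3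
        (Matrix.of fun i j : Fin 3 => if i.val + j.val + 1 = 3 then (1 : L) else 0)).toLocal v
          ((UnitaryGroup.cmDatum L 3 (Matrix.of fun i j : Fin 3 => if i.val + j.val + 1 = 3 then (1 : L) else 0)).toAdelic γ)) → φ v d = 0)
    (hfin : ∀ v ∈ S, (support (φ v) ∩ {d | Corresponds (UnitaryGroup.conjLocal L (IsCMField.complexConj L) v)
        ((UnitaryGroup.adelicForm L 3 H).map (UnitaryGroup.adeleToLocal L v))
        ((UnitaryGroup.adelicForm L 3 (Matrix.of fun i j : Fin 3 => if i.val + j.val + 1 = 3 then (1 : L) else 0)).map (UnitaryGroup.adeleToLocal L v))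
        ((UnitaryGroup.cmDatum L 3 H).toLocal v ((UnitaryGroup.cmDatum L 3 H).toAdelic γ₀)) (Quotient.out d)}).Finite)
    (hfinₐ : (support φₐ ∩ {b | Corresponds (UnitaryGroup.conjMixed (↥(maximalRealSubfield L)) L (IsCMField.complexConj L)) (UnitaryGroup.archFormOf L 3 H)
        (UnitaryGroup.archFormOf L 3 (Matrix.of fun i j : Fin 3 => if i.val + j.val + 1 = 3 then (1 : L) else 0))
        (cmRationalToArch L 3 H γ₀) (Quotient.out b)}).Finite) :
    adelicStableOrbitalSum (MatchingAdeleG.classes L H γ₀) m f =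
      (∑ᶠ b ∈ {b | Corresponds (UnitaryGroup.conjMixed (↥(maximalRealSubfield L)) L (IsCMField.complexConj L)) (UnitaryGroup.archFormOf L 3 H)
          (UnitaryGroup.archFormOf L 3 (Matrix.of fun i j : Fin 3 => if i.val + j.val + 1 = 3 then (1 : L) else 0))
          (cmRationalToArch L 3 H γ₀) (Quotient.out b)}, φₐ b) *
        ∏ v ∈ S, ∑ᶠ d ∈ {d | Corresponds (UnitaryGroup.conjLocal L (IsCMField.complexConj L) v)
          ((UnitaryGroup.adelicForm L 3 H).map (UnitaryGroup.adeleToLocal L v))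
          ((UnitaryGroup.adelicForm L 3 (Matrix.of fun i j : Fin 3 => if i.val + j.val + 1 = 3 then (1 : L) else 0)).map (UnitaryGroup.adeleToLocal L v))
          ((UnitaryGroup.cmDatum L 3 H).toLocal v ((UnitaryGroup.cmDatum L 3 H).toAdelic γ₀)) (Quotient.out d)}, φ v d := by
  refine MatchingAdeleG.adelicStableOrbitalSum_eq_finsum_mul_prod_finsum hKC hreg hγ m f φ φₐ S (fun c hc => ?_) h1 h0 hfin hfinₐ
  obtain ⟨S₂, hS₂, hc'⟩ := hfac c hc
  rw [hc', conjClasses_map_eq_mk_out]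
  congr 1
  simp_rw [conjClasses_map_eq_mk_out]
  refine (finprod_eq_prod_of_mulSupport_subset _ fun v hv => ?_).symm
  rw [Finset.mem_coe]
  by_contra hvS
  exact hv (hS₂ v hvS)

end Factor


/-! ## §2 The inner sums are the local ∕ archimedean stable orbital integrals at `γ_v`, `γ ⊗ 1`; the relation `IsEulerOnClasses` -/

section Euler

variable {L : Type} [Field L] [NumberField L] [IsCMField L] {H : Matrix (Fin 3) (Fin 3) L}
  {γ₀ : (UnitaryGroup.cmDatum L 3 H).Rational}
  {γ : (UnitaryGroup.cmDatum L 3 (Matrix.of fun i j : Fin 3 => if i.val + j.val + 1 = 3 then (1 : L) else 0)).Rational}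

/-- The local classes corresponding to `(γ₀)_v` are exactly the classes STABLY CONJUGATE to `γ_v` for a rational correspondent `γ` (★
`corresponds_toLocal_toAdelic`, ★ `Corresponds.isStablyConj_right` ∕ `.of_isStablyConj_right`). [cite: Rogawski1990, §14.1 p. 232] -/
theorem setOf_corresponds_out_eq_setOf_isStablyConj_local
    (hγ : Corresponds (cmConjRingHom L) H (Matrix.of fun i j : Fin 3 => if i.val + j.val + 1 = 3 then (1 : L) else 0) γ₀ γ)
    (v : HeightOneSpectrum (𝓞 ↥(maximalRealSubfield L))) :
    {d : ConjClasses ((UnitaryGroup.cmDatum L 3 (Matrix.of fun i j : Fin 3 => if i.val + j.val + 1 = 3 then (1 : L) else 0)).Local v) |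
        Corresponds (UnitaryGroup.conjLocal L (IsCMField.complexConj L) v)
          ((UnitaryGroup.adelicForm L 3 H).map (UnitaryGroup.adeleToLocal L v))
          ((UnitaryGroup.adelicForm L 3 (Matrix.of fun i j : Fin 3 => if i.val + j.val + 1 = 3 then (1 : L) else 0)).map (UnitaryGroup.adeleToLocal L v))
          ((UnitaryGroup.cmDatum L 3 H).toLocal v ((UnitaryGroup.cmDatum L 3 H).toAdelic γ₀)) (Quotient.out d)} =
      {d | IsStablyConj (UnitaryGroup.conjLocal L (IsCMField.complexConj L) v)
          ((UnitaryGroup.adelicForm L 3 (Matrix.of fun i j : Fin 3 => if i.val + j.val + 1 = 3 then (1 : L) else 0)).map (UnitaryGroup.adeleToLocal L v))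
          ((UnitaryGroup.cmDatum L 3 (Matrix.of fun i j : Fin 3 => if i.val + j.val + 1 = 3 then (1 : L) else 0)).toLocal v
            ((UnitaryGroup.cmDatum L 3 (Matrix.of fun i j : Fin 3 => if i.val + j.val + 1 = 3 then (1 : L) else 0)).toAdelic γ))
          (Quotient.out d)} :=
  Set.ext fun _ => ⟨fun h => (corresponds_toLocal_toAdelic hγ _).isStablyConj_right h,
    fun h => (corresponds_toLocal_toAdelic hγ _).of_isStablyConj_right h⟩

/-- The archimedean classes corresponding to `γ₀ ⊗ 1` are the classes stably conjugate to `γ ⊗ 1` (★ `corresponds_cmRationalToArch`).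
[cite: Rogawski1990, §14.2 p. 232] -/
theorem setOf_corresponds_out_eq_setOf_isStablyConj_arch
    (hγ : Corresponds (cmConjRingHom L) H (Matrix.of fun i j : Fin 3 => if i.val + j.val + 1 = 3 then (1 : L) else 0) γ₀ γ) :
    {b : ConjClasses (UnitaryGroup.arch (↥(maximalRealSubfield L)) L (IsCMField.complexConj L) 3
        (Matrix.of fun i j : Fin 3 => if i.val + j.val + 1 = 3 then (1 : L) else 0)) |
        Corresponds (UnitaryGroup.conjMixed (↥(maximalRealSubfield L)) L (IsCMField.complexConj L)) (UnitaryGroup.archFormOf L 3 H)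
          (UnitaryGroup.archFormOf L 3 (Matrix.of fun i j : Fin 3 => if i.val + j.val + 1 = 3 then (1 : L) else 0))
          (cmRationalToArch L 3 H γ₀) (Quotient.out b)} =
      {b | IsStablyConj (UnitaryGroup.conjMixed (↥(maximalRealSubfield L)) L (IsCMField.complexConj L))
          (UnitaryGroup.archFormOf L 3 (Matrix.of fun i j : Fin 3 => if i.val + j.val + 1 = 3 then (1 : L) else 0))
          (cmRationalToArch L 3 (Matrix.of fun i j : Fin 3 => if i.val + j.val + 1 = 3 then (1 : L) else 0) γ) (Quotient.out b)} :=
  Set.ext fun _ => ⟨fun h => (corresponds_cmRationalToArch hγ).isStablyConj_right h,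
    fun h => (corresponds_cmRationalToArch hγ).of_isStablyConj_right h⟩

variable
  [∀ g : (UnitaryGroup.cmDatum L 3 (Matrix.of fun i j : Fin 3 => if i.val + j.val + 1 = 3 then (1 : L) else 0)).Adelic,
    MeasurableSpace ((UnitaryGroup.cmDatum L 3 (Matrix.of fun i j : Fin 3 => if i.val + j.val + 1 = 3 then (1 : L) else 0)).Adelic ⧸
      Subgroup.centralizer ({g} : Set (UnitaryGroup.cmDatum L 3 (Matrix.of fun i j : Fin 3 => if i.val + j.val + 1 = 3 then (1 : L) else 0)).Adelic))]
  [∀ (v : HeightOneSpectrum (𝓞 ↥(maximalRealSubfield L)))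
    (x : (UnitaryGroup.cmDatum L 3 (Matrix.of fun i j : Fin 3 => if i.val + j.val + 1 = 3 then (1 : L) else 0)).Local v),
    MeasurableSpace ((UnitaryGroup.cmDatum L 3 (Matrix.of fun i j : Fin 3 => if i.val + j.val + 1 = 3 then (1 : L) else 0)).Local v ⧸
      Subgroup.centralizer ({x} : Set ((UnitaryGroup.cmDatum L 3 (Matrix.of fun i j : Fin 3 => if i.val + j.val + 1 = 3 then (1 : L) else 0)).Local v)))]
  [∀ a : UnitaryGroup.arch (↥(maximalRealSubfield L)) L (IsCMField.complexConj L) 3 (Matrix.of fun i j : Fin 3 => if i.val + j.val + 1 = 3 then (1 : L) else 0),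
    MeasurableSpace (UnitaryGroup.arch (↥(maximalRealSubfield L)) L (IsCMField.complexConj L) 3 (Matrix.of fun i j : Fin 3 => if i.val + j.val + 1 = 3 then (1 : L) else 0) ⧸
      Subgroup.centralizer ({a} : Set (UnitaryGroup.arch (↥(maximalRealSubfield L)) L (IsCMField.complexConj L) 3
        (Matrix.of fun i j : Fin 3 => if i.val + j.val + 1 = 3 then (1 : L) else 0))))]

/-- **`IsEulerOnClasses` for every adelic family whose class orbital integrals factor into LOCAL CLASS ORBITAL INTEGRALS.**  With local families
`mloc v` and test factors `floc v` on `U(Φ₃)(L⁺_v)`, an archimedean family `marc` and factor `farc`, if on `𝒞_𝐀(γ₀)`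
`Φ_m(c, f) = Φ_{marc}(c_∞, farc) · ∏ᶠ_v Φ_{mloc v}(c_v, floc v)` and, off `S`, the base class has unit factor and the other classes of the local
stable class have factor `0`, with finite supports on `S` and at `∞`, then ★ typ3's relation holds:
`IsEulerOnClasses 𝒞_𝐀(γ₀) m f S (v ↦ Φ^st_v(γ_v, floc v; mloc v)) (Φ^st_∞(γ ⊗ 1, farc; marc))` (★ `localStableOrbitalIntegral`, ★ `archStableOrbitalIntegral`
at the rational correspondent `γ`).  The factorisation `hfac` is taken in ★ C3's finite-set shape (per class `c` a finite `S₂` with unit factors off it). [cite: Rogawski1990, §4.3 p. 44; §5.4 (5.4.3) pp. 72–73] [cite: Kottwitz1986, Prop. 7.1] -/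
theorem MatchingAdeleG.isEulerOnClasses_of_factor (hKC : MatchingAdeleGEventuallyKConj L H)
    (hreg : IsRegularElt (γ₀.val : GL (Fin 3) L))
    (hγ : Corresponds (cmConjRingHom L) H (Matrix.of fun i j : Fin 3 => if i.val + j.val + 1 = 3 then (1 : L) else 0) γ₀ γ)
    (m : OrbitalMeasureFamily (UnitaryGroup.cmDatum L 3 (Matrix.of fun i j : Fin 3 => if i.val + j.val + 1 = 3 then (1 : L) else 0)).Adelic)
    (f : (UnitaryGroup.cmDatum L 3 (Matrix.of fun i j : Fin 3 => if i.val + j.val + 1 = 3 then (1 : L) else 0)).Adelic → ℂ)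
    (mloc : ∀ v : HeightOneSpectrum (𝓞 ↥(maximalRealSubfield L)),
      OrbitalMeasureFamily ((UnitaryGroup.cmDatum L 3 (Matrix.of fun i j : Fin 3 => if i.val + j.val + 1 = 3 then (1 : L) else 0)).Local v))
    (floc : ∀ v : HeightOneSpectrum (𝓞 ↥(maximalRealSubfield L)),
      (UnitaryGroup.cmDatum L 3 (Matrix.of fun i j : Fin 3 => if i.val + j.val + 1 = 3 then (1 : L) else 0)).Local v → ℂ)
    (marc : OrbitalMeasureFamily (UnitaryGroup.arch (↥(maximalRealSubfield L)) L (IsCMField.complexConj L) 3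
      (Matrix.of fun i j : Fin 3 => if i.val + j.val + 1 = 3 then (1 : L) else 0)))
    (farc : UnitaryGroup.arch (↥(maximalRealSubfield L)) L (IsCMField.complexConj L) 3
      (Matrix.of fun i j : Fin 3 => if i.val + j.val + 1 = 3 then (1 : L) else 0) → ℂ)
    (S : Finset (HeightOneSpectrum (𝓞 ↥(maximalRealSubfield L))))
    (hfac : ∀ c ∈ MatchingAdeleG.classes L H γ₀, ∃ S₂ : Finset (HeightOneSpectrum (𝓞 ↥(maximalRealSubfield L))),
      (∀ v ∉ S₂, classOrbitalIntegral (mloc v) (floc v) (ConjClasses.mk ((UnitaryGroup.cmDatum L 3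
        (Matrix.of fun i j : Fin 3 => if i.val + j.val + 1 = 3 then (1 : L) else 0)).toLocal v (Quotient.out c))) = 1) ∧
      classOrbitalIntegral m f c =
        classOrbitalIntegral marc farc (ConjClasses.mk (UnitaryGroup.archPart (↥(maximalRealSubfield L)) L (IsCMField.complexConj L) 3
          (Matrix.of fun i j : Fin 3 => if i.val + j.val + 1 = 3 then (1 : L) else 0) (Quotient.out c))) *
        ∏ v ∈ S₂, classOrbitalIntegral (mloc v) (floc v) (ConjClasses.mk ((UnitaryGroup.cmDatum L 3
          (Matrix.of fun i j : Fin 3 => if i.val + j.val + 1 = 3 then (1 : L) else 0)).toLocal v (Quotient.out c))))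
    (h1 : ∀ v ∉ S, classOrbitalIntegral (mloc v) (floc v) (ConjClasses.mk ((UnitaryGroup.cmDatum L 3
      (Matrix.of fun i j : Fin 3 => if i.val + j.val + 1 = 3 then (1 : L) else 0)).toLocal v
        ((UnitaryGroup.cmDatum L 3 (Matrix.of fun i j : Fin 3 => if i.val + j.val + 1 = 3 then (1 : L) else 0)).toAdelic γ))) = 1)
    (h0 : ∀ v ∉ S, ∀ d, Corresponds (UnitaryGroup.conjLocal L (IsCMField.complexConj L) v)
        ((UnitaryGroup.adelicForm L 3 H).map (UnitaryGroup.adeleToLocal L v))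
        ((UnitaryGroup.adelicForm L 3 (Matrix.of fun i j : Fin 3 => if i.val + j.val + 1 = 3 then (1 : L) else 0)).map (UnitaryGroup.adeleToLocal L v))
        ((UnitaryGroup.cmDatum L 3 H).toLocal v ((UnitaryGroup.cmDatum L 3 H).toAdelic γ₀)) (Quotient.out d) →
      d ≠ ConjClasses.mk ((UnitaryGroup.cmDatum L 3
        (Matrix.of fun i j : Fin 3 => if i.val + j.val + 1 = 3 then (1 : L) else 0)).toLocal v
          ((UnitaryGroup.cmDatum L 3 (Matrix.of fun i j : Fin 3 => if i.val + j.val + 1 = 3 then (1 : L) else 0)).toAdelic γ)) →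
      classOrbitalIntegral (mloc v) (floc v) d = 0)
    (hfin : ∀ v ∈ S, (support (classOrbitalIntegral (mloc v) (floc v)) ∩ {d | Corresponds (UnitaryGroup.conjLocal L (IsCMField.complexConj L) v)
        ((UnitaryGroup.adelicForm L 3 H).map (UnitaryGroup.adeleToLocal L v))
        ((UnitaryGroup.adelicForm L 3 (Matrix.of fun i j : Fin 3 => if i.val + j.val + 1 = 3 then (1 : L) else 0)).map (UnitaryGroup.adeleToLocal L v))
        ((UnitaryGroup.cmDatum L 3 H).toLocal v ((UnitaryGroup.cmDatum L 3 H).toAdelic γ₀)) (Quotient.out d)}).Finite)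
    (hfinₐ : (support (classOrbitalIntegral marc farc) ∩ {b | Corresponds (UnitaryGroup.conjMixed (↥(maximalRealSubfield L)) L (IsCMField.complexConj L))
        (UnitaryGroup.archFormOf L 3 H) (UnitaryGroup.archFormOf L 3 (Matrix.of fun i j : Fin 3 => if i.val + j.val + 1 = 3 then (1 : L) else 0))
        (cmRationalToArch L 3 H γ₀) (Quotient.out b)}).Finite) :
    IsEulerOnClasses (MatchingAdeleG.classes L H γ₀) m f S
      (fun v => localStableOrbitalIntegral L 3 (Matrix.of fun i j : Fin 3 => if i.val + j.val + 1 = 3 then (1 : L) else 0) v (mloc v) (floc v)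
        ((UnitaryGroup.cmDatum L 3 (Matrix.of fun i j : Fin 3 => if i.val + j.val + 1 = 3 then (1 : L) else 0)).toLocal v
          ((UnitaryGroup.cmDatum L 3 (Matrix.of fun i j : Fin 3 => if i.val + j.val + 1 = 3 then (1 : L) else 0)).toAdelic γ)))
      (archStableOrbitalIntegral L 3 (Matrix.of fun i j : Fin 3 => if i.val + j.val + 1 = 3 then (1 : L) else 0) marc farc
        (cmRationalToArch L 3 (Matrix.of fun i j : Fin 3 => if i.val + j.val + 1 = 3 then (1 : L) else 0) γ)) := by
  rw [IsEulerOnClasses, MatchingAdeleG.adelicStableOrbitalSum_eq_finsum_mul_prod_finsum_of_finset hKC hreg hγ m f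
      (fun v => classOrbitalIntegral (mloc v) (floc v)) (classOrbitalIntegral marc farc) S hfac h1 h0 hfin hfinₐ]
  congr 1
  · -- the archimedean stable orbital integral at `γ ⊗ 1` is the sum over the classes corresponding to `γ₀ ⊗ 1`
    rw [archStableOrbitalIntegral, stableOrbitalIntegralRel_def]
    exact finsum_mem_congr (setOf_corresponds_out_eq_setOf_isStablyConj_arch hγ) fun _ _ => rfl
  · refine Finset.prod_congr rfl fun v _ => ?_
    rw [localStableOrbitalIntegral, stableOrbitalIntegralRel_def]
    exact finsum_mem_congr (setOf_corresponds_out_eq_setOf_isStablyConj_local hγ v) fun _ _ => rfl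

end Euler

end Literature.NumberTheory.Rogawski1990

end
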